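import Mathlib
import HarnessLib

/-!
# Stub `stub_zeroMeanWindow` (P3b) of line `Sketch`, crux stmt-AtomisticToContinuum-13416

This file is stub P3b of line `Sketch` (idea `zero-mean-dyadic-splice`) of the crux
`Summit.AtomisticToContinuum.FouriersLaw.Theses.StaticAbelianSqueeze.UniformAbelianRegularity`
(item stmt-AtomisticToContinuum-13416). It closes nothing by itself: it is the pure real-analysis
"zero-mean window lemma" consumed by the composition `UniformAbelianRegularity_of` of the skeleton
`Lines/Sketch.lean`.

Statement: `σ` is a finite measure on `ℝ` whose restriction to the window `(−δ₀, δ₀)` is `g dω`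
with `g ≥ 0` measurable and continuous at `0`; `W` is a measurable early window, `|W| ≤ 1` on
`(0, ∞)`, `W = 0` on `[τ, ∞)`, whose cosine transform `Ŵ(ω) = ∫₀^∞ W(t) cos(ωt) dt` is a negative
Lorentzian up to `M/(τω²)` and has nearly zero mean on symmetric intervals. Then
`|∫₀^∞ W(t) (∫ cos(ωt) dσ(ω)) dt| ≤ ε` once `ν ≤ ν₁(ε)` and `τ ≥ τ₁(ε)`.

Proof: Fubini gives `∫₀^∞ W · (∫ cos dσ) = ∫ Ŵ dσ`; off the window `|Ŵ| ≤ (ν + M/τ)/δ₀²`; on the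
window `σ = g dω` and `∫ g Ŵ = ∫ (g − g(0)) Ŵ + g(0) ∫ Ŵ`: the last term is small by the zero-mean
hypothesis, and `|(g − g(0)) Ŵ| ≤ η · (Lorentzian majorant of mass ≤ π(3 + 2M)) + (ν + M/τ)/r² · (g + g(0))`
pointwise, with `η, r` from the continuity of `g` at `0`.
-/

noncomputable section

namespace Summit.AtomisticToContinuum.FouriersLaw.Theorems.UniformAbelianRegularity.ZeroMeanDyadicSplice

open MeasureTheory Set Filter Topology Real

/-! ## Lorentzian majorants -/

/-- `∫_a^b s/(s² + ω²) dω = arctan(b/s) − arctan(a/s) ≤ π` for `s > 0`. -/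
theorem zmw_intervalIntegral_lorentz_le {s : ℝ} (hs : 0 < s) (a b : ℝ) :
    ∫ ω in a..b, s / (s ^ 2 + ω ^ 2) ≤ π := by
  have hcont : Continuous fun ω : ℝ => s / (s ^ 2 + ω ^ 2) :=
    continuous_const.div (by fun_prop) fun ω => by positivity
  have hderiv : ∀ ω ∈ uIcc a b, HasDerivAt (fun ω => arctan (ω / s)) (s / (s ^ 2 + ω ^ 2)) ω := by
    intro ω _
    have h : HasDerivAt (fun ω => arctan (ω / s)) (1 / (1 + (ω / s) ^ 2) * (1 / s)) ω :=
      ((hasDerivAt_id' ω).div_const s).arctan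
    refine h.congr_deriv ?_
    field_simp
  rw [intervalIntegral.integral_eq_sub_of_hasDerivAt hderiv (hcont.intervalIntegrable _ _)]
  have h1 := arctan_lt_pi_div_two (b / s)
  have h2 := neg_pi_div_two_lt_arctan (a / s)
  linarith

/-- `∫_{(a,b)} s/(s² + ω²) dω ≤ π` for `s > 0`, set-integral form. -/
theorem zmw_setIntegral_lorentz_le {s a b : ℝ} (hs : 0 < s) (hab : a ≤ b) :
    ∫ ω in Ioo a b, s / (s ^ 2 + ω ^ 2) ≤ π := by
  rw [← integral_Ioc_eq_integral_Ioo, ← intervalIntegral.integral_of_le hab]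
  exact zmw_intervalIntegral_lorentz_le hs a b

/-- Majorant mass: `∫_{(a,b)} (ν/(ν²+ω²) + 2(1+M) τ⁻¹/(τ⁻²+ω²)) dω ≤ π (3 + 2M)`. -/
theorem zmw_setIntegral_majorant_le {ν τ M a b : ℝ} (hν : 0 < ν) (hτ : 0 < τ) (hM : 0 ≤ M) (hab : a ≤ b) :
    ∫ ω in Ioo a b, (ν / (ν ^ 2 + ω ^ 2) + 2 * (1 + M) * (τ⁻¹ / (τ⁻¹ ^ 2 + ω ^ 2))) ≤
      π * (3 + 2 * M) := by
  have hi : ∀ s : ℝ, 0 < s → IntegrableOn (fun ω => s / (s ^ 2 + ω ^ 2)) (Ioo a b) := fun s hs =>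
    (continuous_const.div (by fun_prop) fun ω => by positivity).integrableOn_Icc.mono_set
      Ioo_subset_Icc_self
  rw [integral_add (hi ν hν) ((hi τ⁻¹ (inv_pos.mpr hτ)).const_mul _), integral_const_mul]
  have h1 := zmw_setIntegral_lorentz_le hν hab
  have h2 := mul_le_mul_of_nonneg_left (zmw_setIntegral_lorentz_le (inv_pos.mpr hτ) hab)
    (by positivity : (0:ℝ) ≤ 2 * (1 + M))
  linarith

/-! ## The early window and its cosine transform -/

section Window

variable {W : ℝ → ℝ} {τ : ℝ}

/-- `W` vanishes past `τ`, so its cosine transform is an integral over `(0, τ]`. -/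
theorem zmw_transform_eq_Ioc (hWτ : ∀ t : ℝ, τ ≤ t → W t = 0) (ω : ℝ) :
    ∫ t in Ioi (0:ℝ), W t * Real.cos (ω * t) = ∫ t in Ioc 0 τ, W t * Real.cos (ω * t) := by
  refine setIntegral_eq_of_subset_of_forall_sdiff_eq_zero measurableSet_Ioi Ioc_subset_Ioi_self ?_
  rintro t ⟨ht, ht'⟩
  have : τ ≤ t := by
    by_contra h
    exact ht' ⟨ht, (not_le.mp h).le⟩
  simp [hWτ t this]

/-- `|Ŵ(ω)| ≤ τ`. -/
theorem zmw_abs_transform_le (hτ : 0 ≤ τ) (hW1 : ∀ t : ℝ, 0 < t → |W t| ≤ 1)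
    (hWτ : ∀ t : ℝ, τ ≤ t → W t = 0) (ω : ℝ) :
    |∫ t in Ioi (0:ℝ), W t * Real.cos (ω * t)| ≤ τ := by
  rw [zmw_transform_eq_Ioc hWτ, ← Real.norm_eq_abs]
  have h := norm_setIntegral_le_of_norm_le_const (measure_Ioc_lt_top (μ := volume))
    (f := fun t => W t * Real.cos (ω * t)) (C := 1) (s := Ioc (0:ℝ) τ) fun t ht => by
      rw [norm_mul, Real.norm_eq_abs, Real.norm_eq_abs]
      exact mul_le_one₀ (hW1 t ht.1) (abs_nonneg _) (abs_cos_le_one _)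
  rwa [Real.volume_real_Ioc_of_le hτ, sub_zero, one_mul] at h

/-- `W` is integrable on `(0, ∞)`. -/
theorem zmw_integrableOn_window (hWm : Measurable W) (hW1 : ∀ t : ℝ, 0 < t → |W t| ≤ 1)
    (hWτ : ∀ t : ℝ, τ ≤ t → W t = 0) : IntegrableOn W (Ioi (0:ℝ)) := by
  have h1 : IntegrableOn W (Ioc 0 τ) :=
    IntegrableOn.of_bound measure_Ioc_lt_top hWm.aestronglyMeasurable 1
      ((ae_restrict_mem measurableSet_Ioc).mono fun t ht => by
        rw [Real.norm_eq_abs]; exact hW1 t ht.1)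
  have h2 : IntegrableOn W (Ioi τ) :=
    integrableOn_zero.congr_fun (fun t ht => (hWτ t (le_of_lt ht)).symm) measurableSet_Ioi
  refine (h1.union h2).mono_set fun t ht => ?_
  rcases le_or_gt t τ with h | h
  · exact Or.inl ⟨ht, h⟩
  · exact Or.inr h

/-- The Fubini integrand `(t, ω) ↦ W(t) cos(ωt)` is integrable on `(0,∞) × σ`. -/
theorem zmw_integrable_uncurry (σ : Measure ℝ) [IsFiniteMeasure σ] (hWm : Measurable W)
    (hW1 : ∀ t : ℝ, 0 < t → |W t| ≤ 1) (hWτ : ∀ t : ℝ, τ ≤ t → W t = 0) :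
    Integrable (Function.uncurry fun (t ω : ℝ) => W t * Real.cos (ω * t))
      ((volume.restrict (Ioi (0:ℝ))).prod σ) := by
  have hb : Integrable (fun z : ℝ × ℝ => ‖W z.1‖ * (1 : ℝ)) ((volume.restrict (Ioi (0:ℝ))).prod σ) :=
    (zmw_integrableOn_window hWm hW1 hWτ).norm.mul_prod (integrable_const 1)
  refine hb.mono' ((hWm.comp measurable_fst).mul
    (Real.measurable_cos.comp (measurable_snd.mul measurable_fst))).aestronglyMeasurable
    (Eventually.of_forall fun z => ?_)
  change ‖W z.1 * Real.cos (z.2 * z.1)‖ ≤ ‖W z.1‖ * 1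
  rw [norm_mul, Real.norm_eq_abs (Real.cos _)]
  exact mul_le_mul_of_nonneg_left (abs_cos_le_one _) (norm_nonneg _)

/-- Fubini: `∫₀^∞ W(t) (∫ cos(ωt) dσ) dt = ∫ Ŵ(ω) dσ`. -/
theorem zmw_integral_window_mul_cosTransform (σ : Measure ℝ) [IsFiniteMeasure σ] (hWm : Measurable W)
    (hW1 : ∀ t : ℝ, 0 < t → |W t| ≤ 1) (hWτ : ∀ t : ℝ, τ ≤ t → W t = 0) :
    ∫ t in Ioi (0:ℝ), W t * ∫ ω, Real.cos (ω * t) ∂σ =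
      ∫ ω, (∫ t in Ioi (0:ℝ), W t * Real.cos (ω * t)) ∂σ := by
  rw [← integral_integral_swap (zmw_integrable_uncurry σ hWm hW1 hWτ)]
  exact integral_congr_ae (Eventually.of_forall fun t => (integral_const_mul (W t) _).symm)

/-- `Ŵ` is measurable. -/
theorem zmw_measurable_cosTransform (hWm : Measurable W) :
    Measurable fun ω : ℝ => ∫ t in Ioi (0:ℝ), W t * Real.cos (ω * t) := by
  have h : StronglyMeasurable (Function.uncurry fun (ω t : ℝ) => W t * Real.cos (ω * t)) :=
    ((hWm.comp measurable_snd).mul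
      (Real.measurable_cos.comp (measurable_fst.mul measurable_snd))).stronglyMeasurable
  exact (h.integral_prod_right (ν := volume.restrict (Ioi (0:ℝ)))).measurable

end Window

/-! ## Pointwise bounds on the transform -/

section Transform

variable {Wc : ℝ → ℝ} {ν τ M : ℝ}

/-- From the Lorentzian hypothesis: `|Ŵ(ω)| ≤ ν/(ν²+ω²) + M/(τω²)` for `ω ≠ 0`. -/
theorem zmw_abs_le_lorentz_add (hν : 0 < ν)
    (hb2 : ∀ ω : ℝ, ω ≠ 0 → |Wc ω + ν / (ν ^ 2 + ω ^ 2)| ≤ M / (τ * ω ^ 2)) {ω : ℝ} (hω : ω ≠ 0) :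
    |Wc ω| ≤ ν / (ν ^ 2 + ω ^ 2) + M / (τ * ω ^ 2) := by
  have h := hb2 ω hω
  have e : Wc ω = (Wc ω + ν / (ν ^ 2 + ω ^ 2)) - ν / (ν ^ 2 + ω ^ 2) := by ring
  rw [e]
  refine (abs_sub _ _).trans ?_
  rw [abs_of_nonneg (by positivity : 0 ≤ ν / (ν ^ 2 + ω ^ 2))]
  linarith

/-- Far bound: for `|ω| ≥ r > 0`, `|Ŵ(ω)| ≤ (ν + M/τ)/r²`. -/
theorem zmw_abs_le_far (hν : 0 < ν) (hτ : 0 < τ) (hM : 0 ≤ M)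
    (hb2 : ∀ ω : ℝ, ω ≠ 0 → |Wc ω + ν / (ν ^ 2 + ω ^ 2)| ≤ M / (τ * ω ^ 2)) {r ω : ℝ}
    (hr : 0 < r) (hrω : r ≤ |ω|) : |Wc ω| ≤ (ν + M / τ) / r ^ 2 := by
  have hω : ω ≠ 0 := abs_pos.mp (hr.trans_le hrω)
  have hω2 : 0 < ω ^ 2 := by positivity
  have h2 : ν / (ν ^ 2 + ω ^ 2) ≤ ν / ω ^ 2 :=
    div_le_div_of_nonneg_left hν.le hω2 (by nlinarith)
  have h3 : r ^ 2 ≤ ω ^ 2 := by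
    rw [← sq_abs ω]; exact pow_le_pow_left₀ hr.le hrω 2
  calc |Wc ω| ≤ ν / ω ^ 2 + M / (τ * ω ^ 2) := by linarith [zmw_abs_le_lorentz_add hν hb2 hω]
    _ = (ν + M / τ) / ω ^ 2 := by rw [add_div, div_div]
    _ ≤ (ν + M / τ) / r ^ 2 := div_le_div_of_nonneg_left (by positivity) (by positivity) h3

/-- Lorentzian majorant: `|Ŵ(ω)| ≤ ν/(ν²+ω²) + 2(1+M) τ⁻¹/(τ⁻² + ω²)` for every `ω`. -/
theorem zmw_abs_le_majorant (hν : 0 < ν) (hτ : 0 < τ) (hM : 0 ≤ M) (hbd : ∀ ω, |Wc ω| ≤ τ)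
    (hb2 : ∀ ω : ℝ, ω ≠ 0 → |Wc ω + ν / (ν ^ 2 + ω ^ 2)| ≤ M / (τ * ω ^ 2)) (ω : ℝ) :
    |Wc ω| ≤ ν / (ν ^ 2 + ω ^ 2) + 2 * (1 + M) * (τ⁻¹ / (τ⁻¹ ^ 2 + ω ^ 2)) := by
  have hL : 0 ≤ ν / (ν ^ 2 + ω ^ 2) := by positivity
  have key : τ⁻¹ / (τ⁻¹ ^ 2 + ω ^ 2) = τ / (1 + τ ^ 2 * ω ^ 2) := by
    field_simp
  rw [key]
  rcases le_or_gt (τ ^ 2 * ω ^ 2) 1 with h | h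
  · have h1 : τ / 2 ≤ τ / (1 + τ ^ 2 * ω ^ 2) :=
      div_le_div_of_nonneg_left hτ.le (by positivity) (by linarith)
    have h2 := hbd ω
    nlinarith
  · have hω : ω ≠ 0 := by
      rintro rfl
      simp at h
      linarith
    have hω2 : 0 < ω ^ 2 := by positivity
    have h1 := zmw_abs_le_lorentz_add hν hb2 hω
    have h2 : M / (τ * ω ^ 2) ≤ 2 * M * (τ / (1 + τ ^ 2 * ω ^ 2)) := by
      rw [← mul_div_assoc, div_le_div_iff₀ (by positivity) (by positivity)]
      nlinarith [mul_nonneg hM hτ.le]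
    have h3 : 0 ≤ τ / (1 + τ ^ 2 * ω ^ 2) := by positivity
    nlinarith

end Transform

/-! ## The three pieces of `∫ Ŵ dσ` -/

/-- The window estimate: with `|g − g₀| ≤ η` on `(−r, r)` and the two bounds on `Ŵ`,
`|∫_{win} (g − g₀) Ŵ| ≤ η π (3 + 2M) + (ν + M/τ)/r² (∫_{win} g + 2 δ₀ g₀)`. -/
theorem zmw_window_bound {g Wc : ℝ → ℝ} {δ₀ g₀ η r ν τ M : ℝ} (hδ₀ : 0 < δ₀) (hg₀ : 0 ≤ g₀)
    (hη : 0 ≤ η) (hr : 0 < r) (hν : 0 < ν) (hτ : 0 < τ) (hM : 0 ≤ M)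
    (hgi : IntegrableOn g (Ioo (-δ₀) δ₀)) (hgnn : ∀ ω ∈ Ioo (-δ₀) δ₀, 0 ≤ g ω)
    (hgc : ∀ ω : ℝ, |ω| < r → |g ω - g₀| ≤ η) (hbd : ∀ ω, |Wc ω| ≤ τ)
    (hb2 : ∀ ω : ℝ, ω ≠ 0 → |Wc ω + ν / (ν ^ 2 + ω ^ 2)| ≤ M / (τ * ω ^ 2)) :
    |∫ ω in Ioo (-δ₀) δ₀, (g ω - g₀) * Wc ω| ≤
      η * (π * (3 + 2 * M)) +
        (ν + M / τ) / r ^ 2 * ((∫ ω in Ioo (-δ₀) δ₀, g ω) + 2 * δ₀ * g₀) := by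
  set K := (ν + M / τ) / r ^ 2 with hK
  have hK0 : 0 ≤ K := by positivity
  set maj : ℝ → ℝ := fun ω => ν / (ν ^ 2 + ω ^ 2) + 2 * (1 + M) * (τ⁻¹ / (τ⁻¹ ^ 2 + ω ^ 2))
    with hmaj
  have hc : ∀ s : ℝ, 0 < s → Continuous (fun ω : ℝ => s / (s ^ 2 + ω ^ 2)) := fun s hs =>
    continuous_const.div (by fun_prop) fun ω => by positivity
  have hmaj_int : IntegrableOn maj (Ioo (-δ₀) δ₀) :=
    ((hc ν hν).add (continuous_const.mul (hc τ⁻¹ (inv_pos.mpr hτ)))).integrableOn_Icc.mono_set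
      Ioo_subset_Icc_self
  have hconst_int : IntegrableOn (fun _ : ℝ => g₀) (Ioo (-δ₀) δ₀) :=
    integrableOn_const measure_Ioo_lt_top.ne
  have hgg₀ : IntegrableOn (fun ω => g ω + g₀) (Ioo (-δ₀) δ₀) := hgi.add hconst_int
  have hI1 : IntegrableOn (fun ω => η * maj ω) (Ioo (-δ₀) δ₀) := hmaj_int.const_mul η
  have hI2 : IntegrableOn (fun ω => K * (g ω + g₀)) (Ioo (-δ₀) δ₀) := hgg₀.const_mul K
  have hB : IntegrableOn (fun ω => η * maj ω + K * (g ω + g₀)) (Ioo (-δ₀) δ₀) := hI1.add hI2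
  have hpt : ∀ᵐ ω ∂(volume.restrict (Ioo (-δ₀) δ₀)),
      ‖(g ω - g₀) * Wc ω‖ ≤ η * maj ω + K * (g ω + g₀) := by
    filter_upwards [ae_restrict_mem measurableSet_Ioo] with ω hω
    rw [Real.norm_eq_abs, abs_mul]
    have hmajnn : 0 ≤ maj ω := by simp only [hmaj]; positivity
    have hgω := hgnn ω hω
    rcases lt_or_ge |ω| r with h | h
    · calc |g ω - g₀| * |Wc ω| ≤ η * maj ω :=
            mul_le_mul (hgc ω h) (zmw_abs_le_majorant hν hτ hM hbd hb2 ω) (abs_nonneg _) hη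
        _ ≤ η * maj ω + K * (g ω + g₀) := le_add_of_nonneg_right (by positivity)
    · have h1 : |g ω - g₀| ≤ g ω + g₀ :=
        (abs_sub _ _).trans (by rw [abs_of_nonneg hgω, abs_of_nonneg hg₀])
      calc |g ω - g₀| * |Wc ω| ≤ (g ω + g₀) * K :=
            mul_le_mul h1 (zmw_abs_le_far hν hτ hM hb2 hr h) (abs_nonneg _) (by positivity)
        _ = K * (g ω + g₀) := mul_comm _ _
        _ ≤ η * maj ω + K * (g ω + g₀) := le_add_of_nonneg_left (by positivity)
  have hmain := norm_integral_le_of_norm_le hB hpt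
  rw [Real.norm_eq_abs, integral_add hI1 hI2, integral_const_mul, integral_const_mul,
    integral_add hgi hconst_int, setIntegral_const, Real.volume_real_Ioo_of_le (by linarith),
    smul_eq_mul] at hmain
  have hm := mul_le_mul_of_nonneg_left (zmw_setIntegral_majorant_le hν hτ hM (by linarith : -δ₀ ≤ δ₀)) hη
  have e : (δ₀ - -δ₀) * g₀ = 2 * δ₀ * g₀ := by ring
  rw [e] at hmain
  linarith

/-- Off the window: `|∫_{winᶜ} Ŵ dσ| ≤ (ν + M/τ)/δ₀² · σ(ℝ)`. -/
theorem zmw_far_bound (σ : Measure ℝ) [IsFiniteMeasure σ] {Wc : ℝ → ℝ} {δ₀ ν τ M : ℝ} (hδ₀ : 0 < δ₀)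
    (hν : 0 < ν) (hτ : 0 < τ) (hM : 0 ≤ M)
    (hb2 : ∀ ω : ℝ, ω ≠ 0 → |Wc ω + ν / (ν ^ 2 + ω ^ 2)| ≤ M / (τ * ω ^ 2)) :
    |∫ ω in (Ioo (-δ₀) δ₀)ᶜ, Wc ω ∂σ| ≤ (ν + M / τ) / δ₀ ^ 2 * σ.real univ := by
  have h := norm_setIntegral_le_of_norm_le_const (measure_lt_top σ _) (f := Wc)
    (s := (Ioo (-δ₀) δ₀)ᶜ) (C := (ν + M / τ) / δ₀ ^ 2) fun ω hω => by
      rw [Real.norm_eq_abs]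
      refine zmw_abs_le_far hν hτ hM hb2 hδ₀ ?_
      simp only [mem_compl_iff, mem_Ioo, not_and_or, not_lt] at hω
      rcases hω with h | h
      · rw [abs_of_neg (by linarith)]
        linarith
      · exact h.trans (le_abs_self ω)
  rw [Real.norm_eq_abs] at h
  exact h.trans (mul_le_mul_of_nonneg_left (measureReal_mono (subset_univ _)) (by positivity))

/-- The window density: `g` is integrable on the window and `∫_{win} f dσ = ∫_{win} g f dω`. -/
theorem zmw_window_density (σ : Measure ℝ) [IsFiniteMeasure σ] {g : ℝ → ℝ} {δ₀ : ℝ}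
    (hgm : Measurable g) (hgnn : ∀ ω ∈ Ioo (-δ₀) δ₀, 0 ≤ g ω)
    (hσ : σ.restrict (Ioo (-δ₀) δ₀) =
      (volume.restrict (Ioo (-δ₀) δ₀)).withDensity fun ω => ENNReal.ofReal (g ω)) :
    IntegrableOn g (Ioo (-δ₀) δ₀) ∧
      ∀ f : ℝ → ℝ, ∫ ω in Ioo (-δ₀) δ₀, f ω ∂σ = ∫ ω in Ioo (-δ₀) δ₀, g ω * f ω := by
  have hnn : 0 ≤ᵐ[volume.restrict (Ioo (-δ₀) δ₀)] g :=
    (ae_restrict_mem measurableSet_Ioo).mono hgnn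
  refine ⟨⟨hgm.aestronglyMeasurable, (hasFiniteIntegral_iff_ofReal hnn).2 ?_⟩, fun f => ?_⟩
  · have h := congrArg (fun μ : Measure ℝ => μ univ) hσ
    simp only [Measure.restrict_apply_univ, withDensity_apply _ MeasurableSet.univ,
      Measure.restrict_univ] at h
    rw [← h]
    exact measure_lt_top σ _
  · rw [hσ, integral_withDensity_eq_integral_toReal_smul hgm.ennreal_ofReal
      (Eventually.of_forall fun _ => ENNReal.ofReal_lt_top)]
    refine setIntegral_congr_fun measurableSet_Ioo fun ω hω => ?_
    simp [ENNReal.toReal_ofReal (hgnn ω hω)]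

/-! ## The stub -/

/-- **Stub `stub_zeroMeanWindow` (P3b of line `Sketch`; the zero-mean window lemma, abstract form).**
Let `σ` be a finite measure on `ℝ` whose restriction to `(−δ₀, δ₀)` is `g dω` with `g ≥ 0` measurable
and continuous at `0`, and `M ≥ 0`. For every `ε > 0` there are `ν₁, τ₁ > 0` such that for
`0 < ν ≤ ν₁`, `τ ≥ τ₁` and every measurable window `W` with `|W| ≤ 1` on `(0,∞)`, `W = 0` on
`[τ, ∞)`, whose cosine transform `Ŵ(ω) = ∫₀^∞ W(t) cos(ωt) dt` obeys `|Ŵ(ω) + ν/(ν²+ω²)| ≤ M/(τω²)`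
(`ω ≠ 0`) and `|∫_{(−δ,δ)} Ŵ| ≤ Mν(1/δ + 1/(τδ²))` (`δ > 0`): `|∫₀^∞ W(t) (∫ cos(ωt) dσ(ω)) dt| ≤ ε`.
Proof: Fubini; off the window `|Ŵ| ≤ (ν + M/τ)/δ₀²`; on the window `σ = g dω` and
`∫ g Ŵ = ∫ (g − g(0)) Ŵ + g(0) ∫ Ŵ`, the first piece bounded by `zmw_window_bound` (continuity of `g`
at `0` and the Lorentzian majorant of mass `≤ π(3+2M)`), the second by the zero-mean hypothesis.
[folklore] -/
theorem stub_zeroMeanWindow :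
    ∀ (σ : MeasureTheory.Measure ℝ) (g : ℝ → ℝ) (δ₀ M : ℝ), MeasureTheory.IsFiniteMeasure σ → 0 < δ₀ → 0 ≤ M →
      Measurable g → (∀ ω ∈ Set.Ioo (-δ₀) δ₀, 0 ≤ g ω) → ContinuousAt g 0 →
      σ.restrict (Set.Ioo (-δ₀) δ₀) =
        (MeasureTheory.volume.restrict (Set.Ioo (-δ₀) δ₀)).withDensity (fun ω => ENNReal.ofReal (g ω)) →
      ∀ ε : ℝ, 0 < ε → ∃ ν₁ : ℝ, 0 < ν₁ ∧ ∃ τ₁ : ℝ, 0 < τ₁ ∧ ∀ ν : ℝ, 0 < ν → ν ≤ ν₁ → ∀ τ : ℝ, τ₁ ≤ τ →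
        ∀ W : ℝ → ℝ, Measurable W → (∀ t : ℝ, 0 < t → |W t| ≤ 1) → (∀ t : ℝ, τ ≤ t → W t = 0) →
          (∀ ω : ℝ, ω ≠ 0 →
            |(∫ t in Set.Ioi (0:ℝ), W t * Real.cos (ω * t)) + ν / (ν ^ 2 + ω ^ 2)| ≤ M / (τ * ω ^ 2)) →
          (∀ δ : ℝ, 0 < δ →
            |∫ ω in Set.Ioo (-δ) δ, ∫ t in Set.Ioi (0:ℝ), W t * Real.cos (ω * t)| ≤ M * ν * (1 / δ + 1 / (τ * δ ^ 2))) →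
          |∫ t in Set.Ioi (0:ℝ), W t * ∫ ω, Real.cos (ω * t) ∂σ| ≤ ε := by
  intro σ g δ₀ M hfin hδ₀ hM hgm hgnn hgc hσ ε hε
  obtain ⟨hgi, hdens⟩ := zmw_window_density σ hgm hgnn hσ
  have hg₀ : 0 ≤ g 0 := hgnn 0 ⟨by linarith, hδ₀⟩
  have hG : 0 ≤ ∫ ω in Ioo (-δ₀) δ₀, g ω := setIntegral_nonneg measurableSet_Ioo hgnn
  have hS : (0:ℝ) ≤ σ.real univ := measureReal_nonneg
  have hP : 0 < π * (3 + 2 * M) := by positivity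
  obtain ⟨r, hr, hgr⟩ : ∃ r > 0, ∀ ω : ℝ, |ω| < r → |g ω - g 0| ≤ ε / (4 * (π * (3 + 2 * M))) := by
    obtain ⟨r, hr, h⟩ := Metric.continuousAt_iff.mp hgc _
      (by positivity : 0 < ε / (4 * (π * (3 + 2 * M))))
    refine ⟨r, hr, fun ω hω => le_of_lt ?_⟩
    have := @h ω (by simpa [Real.dist_eq] using hω)
    simpa [Real.dist_eq] using this
  set G := ∫ ω in Ioo (-δ₀) δ₀, g ω with hGdef
  set S := σ.real univ with hSdef
  set g₀ := g 0 with hg₀def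
  set A := (G + 2 * δ₀ * g₀) / r ^ 2 + g₀ * M * (1 / δ₀ + 1 / δ₀ ^ 2) + S / δ₀ ^ 2 with hAdef
  set B := M * (G + 2 * δ₀ * g₀) / r ^ 2 + M * S / δ₀ ^ 2 with hBdef
  have hA : 0 ≤ A := by positivity
  have hB : 0 ≤ B := by positivity
  refine ⟨ε / (4 * (A + 1)), by positivity, max 1 (4 * (B + 1) / ε), by positivity, ?_⟩
  intro ν hν hν₁ τ hτ₁ W hWm hW1 hWτ hb2 hb3
  have hτ1 : 1 ≤ τ := le_trans (le_max_left _ _) hτ₁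
  have hτ : 0 < τ := by linarith
  have hτB : 4 * (B + 1) / ε ≤ τ := le_trans (le_max_right _ _) hτ₁
  -- Fubini, then name the transform `Wc = Ŵ`
  rw [zmw_integral_window_mul_cosTransform σ hWm hW1 hWτ]
  obtain ⟨Wc, hWc⟩ : ∃ Wc : ℝ → ℝ, ∀ ω, Wc ω = ∫ t in Ioi (0:ℝ), W t * Real.cos (ω * t) :=
    ⟨_, fun _ => rfl⟩
  simp only [← hWc] at hb2 hb3 ⊢
  have hWcm : Measurable Wc := by
    rw [show Wc = fun ω => ∫ t in Ioi (0:ℝ), W t * Real.cos (ω * t) from funext hWc]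
    exact zmw_measurable_cosTransform hWm
  have hbd : ∀ ω, |Wc ω| ≤ τ := fun ω => by rw [hWc]; exact zmw_abs_transform_le hτ.le hW1 hWτ ω
  have hbd' : ∀ ω, ‖Wc ω‖ ≤ τ := fun ω => by rw [Real.norm_eq_abs]; exact hbd ω
  have hWcσ : Integrable Wc σ :=
    (integrable_const τ).mono' hWcm.aestronglyMeasurable (Eventually.of_forall hbd')
  have hWcwin : IntegrableOn Wc (Ioo (-δ₀) δ₀) :=
    IntegrableOn.of_bound measure_Ioo_lt_top hWcm.aestronglyMeasurable τ (Eventually.of_forall hbd')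
  -- split `∫ Wc dσ` into window and far parts, and the window part at `g₀`
  rw [← integral_add_compl (measurableSet_Ioo (a := -δ₀) (b := δ₀)) hWcσ, hdens Wc]
  have hsplit : ∫ ω in Ioo (-δ₀) δ₀, g ω * Wc ω =
      (∫ ω in Ioo (-δ₀) δ₀, (g ω - g₀) * Wc ω) + g₀ * ∫ ω in Ioo (-δ₀) δ₀, Wc ω := by
    have hI : IntegrableOn (fun ω => (g ω - g₀) * Wc ω) (Ioo (-δ₀) δ₀) :=
      (hgi.sub (integrableOn_const measure_Ioo_lt_top.ne)).mul_bdd hWcm.aestronglyMeasurable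
        (Eventually.of_forall hbd')
    rw [← integral_const_mul, ← integral_add hI (hWcwin.const_mul g₀)]
    exact integral_congr_ae (Eventually.of_forall fun ω => by ring)
  rw [hsplit]
  have e1 := zmw_window_bound hδ₀ hg₀ (by positivity) hr hν hτ hM hgi hgnn hgr hbd hb2
  have e2 : |g₀ * ∫ ω in Ioo (-δ₀) δ₀, Wc ω| ≤ g₀ * (M * ν * (1 / δ₀ + 1 / (τ * δ₀ ^ 2))) := by
    rw [abs_mul, abs_of_nonneg hg₀]
    exact mul_le_mul_of_nonneg_left (hb3 δ₀ hδ₀) hg₀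
  have e3 := zmw_far_bound σ hδ₀ hν hτ hM hb2
  -- bookkeeping
  have hτinv : 1 / (τ * δ₀ ^ 2) ≤ 1 / δ₀ ^ 2 :=
    one_div_le_one_div_of_le (by positivity) (by nlinarith [sq_nonneg δ₀])
  have e2' : g₀ * (M * ν * (1 / δ₀ + 1 / (τ * δ₀ ^ 2))) ≤ g₀ * (M * ν * (1 / δ₀ + 1 / δ₀ ^ 2)) :=
    mul_le_mul_of_nonneg_left (mul_le_mul_of_nonneg_left (by linarith) (by positivity)) hg₀
  have hνA : ν * A ≤ ε / 4 := by
    calc ν * A ≤ ε / (4 * (A + 1)) * A := mul_le_mul_of_nonneg_right hν₁ hA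
      _ ≤ ε / 4 := by
        rw [div_mul_eq_mul_div, div_le_div_iff₀ (by positivity) (by positivity)]
        nlinarith [hε.le, hA]
  have hBτ : B / τ ≤ ε / 4 := by
    have h := (div_le_iff₀ hε).mp hτB
    rw [div_le_iff₀ hτ]
    nlinarith
  have hηP : ε / (4 * (π * (3 + 2 * M))) * (π * (3 + 2 * M)) = ε / 4 := by
    field_simp
  have expand : (ν + M / τ) / r ^ 2 * (G + 2 * δ₀ * g₀) + g₀ * (M * ν * (1 / δ₀ + 1 / δ₀ ^ 2)) +
      (ν + M / τ) / δ₀ ^ 2 * S = ν * A + B / τ := by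
    simp only [hAdef, hBdef]
    field_simp
    ring
  calc |(∫ ω in Ioo (-δ₀) δ₀, (g ω - g₀) * Wc ω) + g₀ * (∫ ω in Ioo (-δ₀) δ₀, Wc ω) +
        ∫ ω in (Ioo (-δ₀) δ₀)ᶜ, Wc ω ∂σ|
      ≤ |∫ ω in Ioo (-δ₀) δ₀, (g ω - g₀) * Wc ω| + |g₀ * ∫ ω in Ioo (-δ₀) δ₀, Wc ω| +
        |∫ ω in (Ioo (-δ₀) δ₀)ᶜ, Wc ω ∂σ| := abs_add_three _ _ _
    _ ≤ ε := by linarith [e1, e2, e3, e2', hνA, hBτ, hηP, expand]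

end Summit.AtomisticToContinuum.FouriersLaw.Theorems.UniformAbelianRegularity.ZeroMeanDyadicSplice

end
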